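import Literature.NumberTheory.EllipticCurves.IsogenyClassFiniteProofs
import Literature.NumberTheory.EllipticCurves.IsogenyVariableChangeProofs
import Literature.NumberTheory.EllipticCurves.IsogenyCompProofs
import Literature.NumberTheory.EllipticCurves.IsogenyDualProofs
import Literature.NumberTheory.EllipticCurves.EichlerShimuraConstructionProofs
import Literature.NumberTheory.EllipticCurves.GlobalMinimalModelProofs
import Literature.NumberTheory.EllipticCurves.BSDInvariantsMinimalModelProofs
import HarnessLib

/-!
# Every isogeny class over `ℚ` has a globally minimal member of MAXIMAL Néron covolume (minimal Faltings height)

Summit `BirchSwinnertonDyer`, route `ManinLocalTwoThree` (cell bsd-f2-manin), deciding crux C2 `ManinOddAtFour`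
(stmt-BirchSwinnertonDyer-22967), reducible residual `Rb` of the line `kato_shift_two` (lead p1).  The es planner's Rb
lever (MEMO-es §27, HOME/es/Sketch-es-g14.lean, E-es-49 `not_two_dvd_maninConstant_of_law`) reads «2-adic polar
sharpness LAW + (∃ max-covolume member in the isogeny class) ⟹ 2 ∤ c»; its second hypothesis

  `∀ W, ∃ V elliptic, globally minimal, isogenous to W, with IsMaxCovolumeInClass V`

(«routine: finite class») is PROVED here, with `IsMaxCovolumeInClass` (es's Prop, not yet in the tree) UNFOLDED:
`exists_isIsogenous_maxCovolume`.  Ingredients, all tree theorems: Shafarevich finiteness of the isogeny class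
(`finite_isogenyClass_holds`, Faltings/Shafarevich *AEC* IX.6.2), global minimal models over `ℚ`
(`hasGlobalMinimalModel_rat_holds`) and their uniqueness up to `u = ±1` (`isGloballyMinimal_unique_holds`, *AEC*
VIII.8.3), existence and uniqueness of the Néron lattice (`exists_isNeronLatticeOf_holds`, `IsNeronLatticeOf.lattice_eq`),
and the elementary remark `isNeronLatticeOf_baseChange_smul_iff`: two globally minimal models of the same curve have the
SAME Néron lattices (`c₄, c₆` are invariant under `u = ±1`).  Then the maximum of the covolume over the finitely many
classes is attained.

No definitions; nothing about BSD or the Manin constant is asserted here.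
-/

set_option autoImplicit false
set_option linter.dupNamespace false

noncomputable section

open scoped Classical

open WeierstrassCurve Literature.NumberTheory.EllipticCurves Literature.NumberTheory.EllipticCurves.ModularForms

namespace Summit.BirchSwinnertonDyer.BirchSwinnertonDyer.Theorems.ManinLocalTwoThree

/-- **Two globally minimal models over `ℚ` of the same curve have the same Néron lattices**: if `V` and `C • V` are
both globally minimal then `C.u = ±1` (`isGloballyMinimal_unique_holds`), so `c₄` and `c₆` — hence the Néron lattice
condition `g₂ = c₄/12, g₃ = c₆/216` — agree. [cite: SilvermanAEC2009, VII.1.3(b) and VIII.8.3] -/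
theorem isNeronLatticeOf_baseChange_smul_iff (V : WeierstrassCurve ℚ) [V.IsElliptic] [V.IsGloballyMinimal]
    (C : VariableChange ℚ) [(C • V).IsGloballyMinimal] (L : PeriodPair) :
    IsNeronLatticeOf ((C • V).baseChange ℂ) L ↔ IsNeronLatticeOf (V.baseChange ℂ) L := by
  obtain ⟨hu, -⟩ := isGloballyMinimal_unique_holds V C
  have hu4 : ((C.u⁻¹ : ℚˣ) : ℚ) ^ 4 = 1 := by
    rcases hu with h | h <;> norm_num [h]
  have hu6 : ((C.u⁻¹ : ℚˣ) : ℚ) ^ 6 = 1 := by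
    rcases hu with h | h <;> norm_num [h]
  have h4 : (C • V).c₄ = V.c₄ := by rw [variableChange_c₄, hu4, one_mul]
  have h6 : (C • V).c₆ = V.c₆ := by rw [variableChange_c₆, hu6, one_mul]
  unfold IsNeronLatticeOf
  simp only [baseChange, map_c₄, map_c₆, h4, h6]

/-- The covolume of the Néron lattice does not depend on the choice of the lattice (plumbing: `IsNeronLatticeOf.lattice_eq`).
[folklore] -/
theorem covolume_eq_of_isNeronLatticeOf {X : WeierstrassCurve ℂ} {L L' : PeriodPair} (h : IsNeronLatticeOf X L)
    (h' : IsNeronLatticeOf X L') : ZLattice.covolume L.lattice = ZLattice.covolume L'.lattice := by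
  have e : L.lattice = L'.lattice := IsNeronLatticeOf.lattice_eq h h'
  simp only [e]

/-- **Every isogeny class of elliptic curves over `ℚ` contains a globally minimal member of maximal Néron covolume**
(= minimal Faltings height; Stevens' `E_min`).  This is the hypothesis `hmin` of the es planner's E-es-49
`not_two_dvd_maninConstant_of_law` with `IsMaxCovolumeInClass` unfolded: the isogeny class is finite up to
`ℚ`-isomorphism (Shafarevich), each class has a global minimal model whose Néron lattice is well defined up to the
sign of `u`, and a finite set of reals has a maximum. [cite: SilvermanAEC2009, Cor. IX.6.2 and VIII.8.3] -/
theorem exists_isIsogenous_maxCovolume (W : WeierstrassCurve ℚ) [W.IsElliptic] :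
    ∃ (V : WeierstrassCurve ℚ) (_ : V.IsElliptic) (_ : V.IsGloballyMinimal), IsIsogenous W V ∧
      ∀ (V' : WeierstrassCurve ℚ) (L L' : PeriodPair), V'.IsElliptic → V'.IsGloballyMinimal →
        IsIsogenous V V' → IsNeronLatticeOf (V.baseChange ℂ) L → IsNeronLatticeOf (V'.baseChange ℂ) L' →
        ZLattice.covolume L'.lattice ≤ ZLattice.covolume L.lattice := by
  obtain ⟨F, hF⟩ := finite_isogenyClass_holds W
  -- a global minimal model and a Néron lattice for every elliptic `X`, and its covolume
  have hmin : ∀ (X : WeierstrassCurve ℚ) [X.IsElliptic], ∃ C : VariableChange ℚ, (C • X).IsGloballyMinimal :=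
    fun X _ ↦ hasGlobalMinimalModel_rat_holds X
  let Cmin : ∀ (X : WeierstrassCurve ℚ) [X.IsElliptic], VariableChange ℚ := fun X _ ↦ Classical.choose (hmin X)
  have hCmin : ∀ (X : WeierstrassCurve ℚ) [X.IsElliptic], (Cmin X • X).IsGloballyMinimal :=
    fun X _ ↦ Classical.choose_spec (hmin X)
  let Lmin : ∀ (X : WeierstrassCurve ℚ) [X.IsElliptic], PeriodPair :=
    fun X _ ↦ Classical.choose (exists_isNeronLatticeOf_holds ((Cmin X • X).baseChange ℂ))
  have hLmin : ∀ (X : WeierstrassCurve ℚ) [X.IsElliptic], IsNeronLatticeOf ((Cmin X • X).baseChange ℂ) (Lmin X) :=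
    fun X _ ↦ Classical.choose_spec (exists_isNeronLatticeOf_holds ((Cmin X • X).baseChange ℂ))
  let cov : WeierstrassCurve ℚ → ℝ := fun X ↦
    if hX : X.IsElliptic then ZLattice.covolume (@Lmin X hX).lattice else 0
  have hcov : ∀ (X : WeierstrassCurve ℚ) [hX : X.IsElliptic], cov X = ZLattice.covolume (Lmin X).lattice :=
    fun X hX ↦ dif_pos hX
  -- the candidates: members of `F` that are elliptic and isogenous to `W`
  let S : Finset (WeierstrassCurve ℚ) := F.filter fun X ↦ ∃ _ : X.IsElliptic, IsIsogenous W X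
  have hSne : S.Nonempty := by
    obtain ⟨C, hC⟩ := hF W (IsIsogenous.refl_holds W)
    exact ⟨C • W, Finset.mem_filter.2 ⟨hC, inferInstance, isIsogenous_smul W C⟩⟩
  obtain ⟨X₀, hX₀S, hmax⟩ := S.exists_max_image cov hSne
  obtain ⟨hX₀F, hX₀e, hWX₀⟩ := Finset.mem_filter.1 hX₀S
  haveI := hX₀e
  haveI := hCmin X₀
  -- the maximiser's minimal model
  refine ⟨Cmin X₀ • X₀, inferInstance, inferInstance, hWX₀.trans' (isIsogenous_smul X₀ (Cmin X₀)),
    fun V' L L' hV'e hV'm hVV' hL hL' ↦ ?_⟩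
  haveI := hV'e
  haveI := hV'm
  -- `covolume L = cov X₀`
  have h1 : ZLattice.covolume L.lattice = cov X₀ := by
    rw [hcov X₀]
    exact covolume_eq_of_isNeronLatticeOf hL (hLmin X₀)
  -- `V'` is represented in `F` by `X₁ = C' • V'`, and `covolume L' = cov X₁`
  have hWV' : IsIsogenous W V' := (hWX₀.trans' (isIsogenous_smul X₀ (Cmin X₀))).trans' hVV'
  obtain ⟨C', hC'⟩ := hF V' hWV'
  haveI : (C' • V').IsElliptic := inferInstance
  haveI := hCmin (C' • V')
  have hX₁S : C' • V' ∈ S := Finset.mem_filter.2 ⟨hC', inferInstance, hWV'.trans' (isIsogenous_smul V' C')⟩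
  have h2 : ZLattice.covolume L'.lattice = cov (C' • V') := by
    rw [hcov (C' • V')]
    -- the minimal model `Cmin • C' • V'` of `C' • V'` and `V'` itself are two global minimal models of one curve
    haveI hmm : ((Cmin (C' • V') * C') • V').IsGloballyMinimal := by
      rw [mul_smul]; exact hCmin (C' • V')
    have hL₁ : IsNeronLatticeOf (((Cmin (C' • V') * C') • V').baseChange ℂ) (Lmin (C' • V')) := by
      rw [mul_smul]; exact hLmin (C' • V')
    rw [isNeronLatticeOf_baseChange_smul_iff V' (Cmin (C' • V') * C')] at hL₁
    exact covolume_eq_of_isNeronLatticeOf hL' hL₁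
  rw [h1, h2]
  exact hmax _ hX₁S

end Summit.BirchSwinnertonDyer.BirchSwinnertonDyer.Theorems.ManinLocalTwoThree

end
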